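import Literature.NumberTheory.Automorphic.GLnAutomorphicUnfolding
import Literature.MeasureTheory.Group.InvariantQuotientUniqueness
import HarnessLib

/-!
# The automorphic measure of `GL_n` is unique up to a positive scalar
(discharge of `AdelicGroupData.isAutomorphicMeasure_unique_smul`; Borel, *Some finiteness
properties of adele groups over number fields*, Publ. Math. IHÉS 16 (1963), §5; Getz–Hahn,
*An Introduction to Automorphic Representations* (2024), Thm. 3.2.2, printed p. 57)

Sibling proof file of `Literature.NumberTheory.Automorphic.AdelicGroupData`. It discharges,
sorry-free, the named fact

* `AdelicGroupData.isAutomorphicMeasure_unique_smul n K` : any two automorphic measures `μ`, `ν`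
  on the automorphic quotient `GL_n(𝔸_K) ⧸ (A_G · GL_n(K))` of the honest datum
  `AdelicGroupData.gl n K` (`IsAutomorphicMeasure`: finite, positive on non-empty open sets, inner
  regular, `GL_n(𝔸_K)`-invariant) satisfy `μ = c • ν` for some `c : ℝ≥0`, `c ≠ 0`,

as `AdelicGroupData.isAutomorphicMeasure_unique_smul_holds`.

Proof. This is the uniqueness clause of the theorem on invariant measures on coset spaces
(Getz–Hahn Thm. 3.2.2, after Folland (1995) Thm. 2.49 and Weil (1940) §9): for a closed subgroup
`H` of a locally compact second countable Hausdorff group `G`, two non-zero `G`-invariant Borel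
measures on `G ⧸ H` finite on compact sets are positive multiples of each other — PROVED in
`Literature.MeasureTheory.Group.InvariantQuotientUniqueness`
(`smulInvariantMeasure_quotient_unique_ne_zero`, via Weil's unfolding formula of
`InvariantQuotientUnfolding` and a Borel test function with everywhere positive finite fibre
integrals). The hypotheses hold for `G = GL_n(𝔸_K)`, `H = A_G · GL_n(K)`: `GL_n(𝔸_K)` is locally
compact (`locallyCompactSpace_gl_adelic_holds`, Platonov–Rapinchuk §5.1), second countable
(`AdelicSecondCountable`) and Hausdorff (`t2Space_gl`); `A_G · GL_n(K)` is closed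
(`isClosed_quotientSubgroup_gl_holds`, Borel (1963) §5 / Weil BNT IV §4); an automorphic measure is
finite (hence finite on compact sets), invariant, and non-zero (positive on the non-empty open
quotient, `automorphicMeasure_ne_zero`). The instances re-keying the tree's Borel structure of
`automorphicQuotient` on the syntactic form `G ⧸ H` are those of `GLnAutomorphicUnfolding`,
supplied inside the proof (no local or global instance is declared in this file).

## References

* A. Borel, *Some finiteness properties of adele groups over number fields*, Publ. Math. IHÉS 16
  (1963), §5 [Borel1963].
* J. R. Getz, H. Hahn, *An Introduction to Automorphic Representations*, GTM 300 (2024),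
  Thm. 3.2.2 (printed p. 57, PDF p. 73 of the held copy) [GetzHahn2024].
* G. B. Folland, *A Course in Abstract Harmonic Analysis* (1995), Thm. 2.49 [Folland1995].
-/

noncomputable section

open MeasureTheory Measure Set Filter Topology IsDedekindDomain NumberField
open Literature.MeasureTheory.Group
open scoped ENNReal NNReal

namespace Literature.NumberTheory.Automorphic

namespace AdelicGroupData

section Discharge

variable (n : ℕ) (K : Type) [Field K] [NumberField K]

/-- **Discharge of `isAutomorphicMeasure_unique_smul`: the automorphic measure on
`GL_n(𝔸_K) ⧸ (A_G · GL_n(K))` is unique up to a positive scalar.** For automorphic measures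
`μ`, `ν` (`IsAutomorphicMeasure`) there is `c : ℝ≥0`, `c ≠ 0`, with `μ = c • ν` — the uniqueness
of invariant Radon measures on the coset space `G ⧸ H` of a locally compact (second countable,
Hausdorff) group by a closed subgroup (Getz–Hahn (2024), Thm. 3.2.2, uniqueness clause, proved
as `Literature.MeasureTheory.Group.smulInvariantMeasure_quotient_unique_ne_zero`), applied to
`G = GL_n(𝔸_K)` (locally compact, second countable, Hausdorff; Borel σ-algebra) and the closed
subgroup `H = A_G · GL_n(K)` (`isClosed_quotientSubgroup_gl_holds`); automorphic measures are
finite, invariant and non-zero (`automorphicMeasure_ne_zero`). The instances are supplied inside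
the proof (the tree's Borel structure of `automorphicQuotient` re-keyed on the syntactic form
`G ⧸ H`: `measurableSpaceQuotient`, `borelSpaceQuotient`, `smulInvariantMeasureQuotient`,
`isFiniteMeasureOnCompactsQuotient` of `GLnAutomorphicUnfolding`). Borel (1963), §5.
[cite: Borel1963, §5] -/
theorem isAutomorphicMeasure_unique_smul_holds : isAutomorphicMeasure_unique_smul n K := by
  intro μ ν _ _
  -- `G = GL_n(𝔸_K)`: Borel σ-algebra, locally compact, second countable (Hausdorff and
  -- `H = A_G · GL_n(K)` closed are instances of `GLnAutomorphicUnfolding`)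
  borelize (AdelicGroupData.gl n K).Adelic
  haveI : LocallyCompactSpace (AdelicGroupData.gl n K).Adelic := locallyCompactSpace_adelic n K
  haveI : SecondCountableTopology (AdelicGroupData.gl n K).Adelic :=
    secondCountableTopology_gl_adelic n K
  -- the quotient `G ⧸ H` with the tree's Borel structure and the two automorphic measures
  letI : MeasurableSpace
      ((AdelicGroupData.gl n K).Adelic ⧸ (AdelicGroupData.gl n K).quotientSubgroup) :=
    measurableSpaceQuotient n K
  haveI : BorelSpace
      ((AdelicGroupData.gl n K).Adelic ⧸ (AdelicGroupData.gl n K).quotientSubgroup) :=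
    borelSpaceQuotient n K
  haveI := smulInvariantMeasureQuotient n K μ
  haveI := smulInvariantMeasureQuotient n K ν
  haveI := isFiniteMeasureOnCompactsQuotient n K μ
  haveI := isFiniteMeasureOnCompactsQuotient n K ν
  exact smulInvariantMeasure_quotient_unique_ne_zero (AdelicGroupData.gl n K).quotientSubgroup
    μ ν (automorphicMeasure_ne_zero n K μ) (automorphicMeasure_ne_zero n K ν)

end Discharge

end AdelicGroupData

end Literature.NumberTheory.Automorphic
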